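import Literature.MathematicalPhysics.QuantumLattice.TorusSectorGibbsScaleCovariance
import HarnessLib

/-!
# The temperature axis of a phase-map cell over a SCALE BOX: unit thermal words on a `β̃`-interval are
# physical thermal words on the whole box (torus-limit thermal convention of the `t–t'` Hubbard model)

Topic `MathematicalPhysics/QuantumLattice` (family `hubbard`); consequences of
`TorusSectorGibbsScaleCovariance` §3 (the thermal torus-limit class of `H(t, ts, tu)` at `β` IS the class
of the unit model `H(1, s, u)` at `βt`) for the BOX → WORD step of the material-oracle pipeline. A
downfolded single-band box carries unit couplings `(s, u, n) = (t'/t, U/t, n)` and a scale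
`t_eV ∈ [t₁, t₂]`; a phase-map cell sits at a physical inverse temperature `β` (`1/(k_B T_K)` in `eV⁻¹`);
as `t` sweeps the scale box the unit inverse temperature `β̃ = βt` sweeps `[βt₁, βt₂]`. Hence:

* `thermalWord_on_scaleBox_of_unit_Icc`: a property `P` of states certified for every unit thermal torus
  limit at every `β̃ ∈ [β̃₁, β̃₂] ⊇ [βt₁, βt₂]` holds for every thermal torus limit of the physical model at
  `β`, for every `t ∈ [t₁, t₂]` (`β ≥ 0`) — DIMENSIONLESS words (correlator / pair / docc words)
  verbatim; one-sided families: `…_of_unit_Ici` (word valid for all `β̃ ≥ θ` — binds at the SMALL end,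
  `θ ≤ βt₁`) and `…_of_unit_Iic` (valid for all `β̃ ≤ θ` — binds at the LARGE end, `βt₂ ≤ θ`); this is the
  kernel form of the interval rule `divPos` / `cmpThreshold` of
  `Summit.Ventures.CertifiedManyBodySolver.Downfold.IntervalCalculus`;
* `meanEnergy_window_on_scaleBox_of_unit_Icc`: thermal ENERGY windows carry one power of the scale —
  a unit window `[lo, hi]` on the `β̃`-interval gives `t·lo ≤ e_{Φ(t,ts,tu)}(ω) ≤ t·hi` on the box;
* `meanEnergy_window_on_scaleBox_of_unit_endpoints`: the assembled temperature axis of a cell — two unit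
  certificates at the ENDS of the `β̃`-interval (cap at the hot end, floor at the cold end, limits along a
  common `Ls → ∞`) give the physical energy window on the whole scale box, by the antitonicity of the
  thermal energy in `β̃` (`meanEnergy_hubbardTTPrime_window_on_interval_of_sectorGibbs`) and §3.

HONEST LIMITS: exact covariance plus monotonicity in `β̃`; nothing here bounds how a word varies with the
temperature inside the interval beyond what the two endpoint certificates give. Everything is PROVED; no
definition, no named fact, no sorry.

## Tree search (cited, not restated)

`InfVolFermionState.isTorusLimitOfMixture_sectorGibbs_scale_iff` (`TorusSectorGibbsScaleCovariance`),
`InfVolFermionState.meanEnergy_hubbardTTPrime_smul` (`HubbardTTPrimeMeanEnergySupergradient`),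
`IsTorusLimitOfMixture.meanEnergy_hubbardTTPrime_window_on_interval_of_sectorGibbs`
(`TorusSectorGibbsEnergyWindow`); Summits-side interval bookkeeping `NonemptyInterval.divPos`,
`cmpThreshold` (`Summits/Ventures/CertifiedManyBodySolver/Downfold/IntervalCalculus`, not importable here).

## References

* D. Ruelle, *Statistical Mechanics: Rigorous Results* (1969), §3.3 (positive homogeneity of the
  thermodynamic functions in the interaction) and §2.5–2.6 (monotonicity of the energy in `β`).
  [cite: Ruelle1969, §3.3]
* O. Bratteli, A. Kishimoto, D. W. Robinson, Commun. Math. Phys. 64 (1978) 41, §3 (the mean energy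
  functional, linear in the interaction). [cite: BratteliKishimotoRobinson1978, §3 (mean energy functional)]
-/

noncomputable section

namespace Literature.MathematicalPhysics.QuantumLattice

open Matrix Finset HubbardWave0 Literature.Probability.LatticeModels ThermodynamicLimit
open _root_.Filter
open scoped _root_.Topology ComplexOrder BigOperators

namespace InfVolFermionState

/-! ### Unit thermal words on a `β̃`-interval ⇒ physical words on a scale box

A downfolded box carries the unit couplings `(s, u, n) = (t'/t, U/t, n)` and a scale `t_eV ∈ [t₁, t₂]`;
a phase-map cell sits at a physical inverse temperature `β` (`= 1/(k_B T_K)` in `eV⁻¹`). By §3 the physical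
thermal states of `H(t, ts, tu)` at `β` are the unit thermal states of `H(1, s, u)` at `β̃ = βt`, and
`β̃` sweeps `[βt₁, βt₂]` over the box. So: a unit word certified for every `β̃` in an interval containing
`[βt₁, βt₂]` holds on the whole scale box (dimensionless words verbatim, energies `× t`). -/

variable {s u n : ℝ} {Ls : ℕ → ℕ}

/-- **Dimensionless thermal words over a scale box.** If a property `P` of states holds for every unit
thermal torus limit (couplings `(1, s, u)`, density `n`, sides `Ls`) at every `β̃ ∈ [β̃₁, β̃₂]`, and the
scale box `[t₁, t₂]` at physical inverse temperature `β ≥ 0` satisfies `β̃₁ ≤ βt₁`, `βt₂ ≤ β̃₂`,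
then `P` holds for every thermal torus limit of the physical model `H(t, ts, tu)` at `β`, for every
`t ∈ [t₁, t₂]` (any real `t`; the box is meant with `t₁ > 0`). [cite: Ruelle1969, §3.3] -/
theorem thermalWord_on_scaleBox_of_unit_Icc (P : InfVolFermionState 2 → Prop)
    {β βu₁ βu₂ t₁ t₂ : ℝ} (hβ : 0 ≤ β) (h₁ : βu₁ ≤ β * t₁) (h₂ : β * t₂ ≤ βu₂)
    (hP : ∀ β' ∈ Set.Icc βu₁ βu₂, ∀ ω : InfVolFermionState 2,
      ω.IsTorusLimitOfMixture (sectorGibbsCount n) (fun L => sectorGibbsWeightTT' β' 1 s u n L)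
        (fun L => sectorGibbsVectorTT' 1 s u n L) Ls → P ω)
    {t : ℝ} (ht : t ∈ Set.Icc t₁ t₂) {ω : InfVolFermionState 2}
    (hω : ω.IsTorusLimitOfMixture (sectorGibbsCount n)
      (fun L => sectorGibbsWeightTT' β t (t * s) (t * u) n L)
      (fun L => sectorGibbsVectorTT' t (t * s) (t * u) n L) Ls) :
    P ω := by
  have hsc := isTorusLimitOfMixture_sectorGibbs_scale_iff ω β t 1 s u n Ls
  rw [mul_one] at hsc
  refine hP (β * t) ⟨?_, ?_⟩ ω (hsc.mp hω)
  · exact h₁.trans (mul_le_mul_of_nonneg_left ht.1 hβ)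
  · exact (mul_le_mul_of_nonneg_left ht.2 hβ).trans h₂

/-- **Low-temperature words over a scale box** (unit word valid for all `β̃ ≥ θ`, e.g. an order or gap
statement below a temperature): it holds for the physical model at `β` for every `t ≥ t₁` of the box as
soon as `θ ≤ βt₁` (`β ≥ 0`) — the "`k_B T/t ≤ 1/θ`" threshold binds at the SMALL end of the scale box.
[cite: Ruelle1969, §3.3] -/
theorem thermalWord_on_scaleBox_of_unit_Ici (P : InfVolFermionState 2 → Prop)
    {β θ t₁ : ℝ} (hβ : 0 ≤ β) (hθ : θ ≤ β * t₁)
    (hP : ∀ β' ∈ Set.Ici θ, ∀ ω : InfVolFermionState 2,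
      ω.IsTorusLimitOfMixture (sectorGibbsCount n) (fun L => sectorGibbsWeightTT' β' 1 s u n L)
        (fun L => sectorGibbsVectorTT' 1 s u n L) Ls → P ω)
    {t : ℝ} (ht : t₁ ≤ t) {ω : InfVolFermionState 2}
    (hω : ω.IsTorusLimitOfMixture (sectorGibbsCount n)
      (fun L => sectorGibbsWeightTT' β t (t * s) (t * u) n L)
      (fun L => sectorGibbsVectorTT' t (t * s) (t * u) n L) Ls) :
    P ω := by
  have hsc := isTorusLimitOfMixture_sectorGibbs_scale_iff ω β t 1 s u n Ls
  rw [mul_one] at hsc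
  exact hP (β * t) (hθ.trans (mul_le_mul_of_nonneg_left ht hβ)) ω (hsc.mp hω)

/-- **High-temperature words over a scale box** (unit word valid for all `β̃ ≤ θ`, e.g. absence of order
above a temperature): it holds for the physical model at `β ≥ 0` for every `t ≤ t₂` of the box as soon
as `βt₂ ≤ θ` — the threshold binds at the LARGE end of the scale box. [cite: Ruelle1969, §3.3] -/
theorem thermalWord_on_scaleBox_of_unit_Iic (P : InfVolFermionState 2 → Prop)
    {β θ t₂ : ℝ} (hβ : 0 ≤ β) (hθ : β * t₂ ≤ θ)
    (hP : ∀ β' ∈ Set.Iic θ, ∀ ω : InfVolFermionState 2,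
      ω.IsTorusLimitOfMixture (sectorGibbsCount n) (fun L => sectorGibbsWeightTT' β' 1 s u n L)
        (fun L => sectorGibbsVectorTT' 1 s u n L) Ls → P ω)
    {t : ℝ} (ht : t ≤ t₂) {ω : InfVolFermionState 2}
    (hω : ω.IsTorusLimitOfMixture (sectorGibbsCount n)
      (fun L => sectorGibbsWeightTT' β t (t * s) (t * u) n L)
      (fun L => sectorGibbsVectorTT' t (t * s) (t * u) n L) Ls) :
    P ω := by
  have hsc := isTorusLimitOfMixture_sectorGibbs_scale_iff ω β t 1 s u n Ls
  rw [mul_one] at hsc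
  exact hP (β * t) ((mul_le_mul_of_nonneg_left ht hβ).trans hθ) ω (hsc.mp hω)

/-- **Thermal ENERGY windows over a scale box** (energies carry one power of the scale): a unit thermal
energy window `lo ≤ e_{Φ(1,s,u)}(ω̃) ≤ hi` certified for every unit thermal torus limit at every
`β̃ ∈ [β̃₁, β̃₂] ⊇ [βt₁, βt₂]` gives `t·lo ≤ e_{Φ(t,ts,tu)}(ω) ≤ t·hi` for every thermal torus limit of the
physical model at `β`, for every `t ∈ [t₁, t₂]` (`0 ≤ t₁`, `β ≥ 0`). [cite: Ruelle1969, §3.3]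
[cite: BratteliKishimotoRobinson1978, §3 (mean energy functional)] -/
theorem meanEnergy_window_on_scaleBox_of_unit_Icc
    {β βu₁ βu₂ t₁ t₂ lo hi : ℝ} (ht₁ : 0 ≤ t₁) (hβ : 0 ≤ β) (h₁ : βu₁ ≤ β * t₁) (h₂ : β * t₂ ≤ βu₂)
    (hW : ∀ β' ∈ Set.Icc βu₁ βu₂, ∀ ω : InfVolFermionState 2,
      ω.IsTorusLimitOfMixture (sectorGibbsCount n) (fun L => sectorGibbsWeightTT' β' 1 s u n L)
        (fun L => sectorGibbsVectorTT' 1 s u n L) Ls →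
        lo ≤ ω.meanEnergy (hubbardTTPrimeFermionInteraction 1 s u) 1 ∧
          ω.meanEnergy (hubbardTTPrimeFermionInteraction 1 s u) 1 ≤ hi)
    {t : ℝ} (ht : t ∈ Set.Icc t₁ t₂) {ω : InfVolFermionState 2}
    (hω : ω.IsTorusLimitOfMixture (sectorGibbsCount n)
      (fun L => sectorGibbsWeightTT' β t (t * s) (t * u) n L)
      (fun L => sectorGibbsVectorTT' t (t * s) (t * u) n L) Ls) :
    t * lo ≤ ω.meanEnergy (hubbardTTPrimeFermionInteraction t (t * s) (t * u)) 1 ∧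
      ω.meanEnergy (hubbardTTPrimeFermionInteraction t (t * s) (t * u)) 1 ≤ t * hi := by
  have hunit := thermalWord_on_scaleBox_of_unit_Icc
    (fun ω => lo ≤ ω.meanEnergy (hubbardTTPrimeFermionInteraction 1 s u) 1 ∧
      ω.meanEnergy (hubbardTTPrimeFermionInteraction 1 s u) 1 ≤ hi) hβ h₁ h₂ hW ht hω
  have hsm := ω.meanEnergy_hubbardTTPrime_smul t 1 s u
  rw [mul_one] at hsm
  have htpos : 0 ≤ t := ht₁.trans ht.1
  rw [hsm]
  exact ⟨mul_le_mul_of_nonneg_left hunit.1 htpos, mul_le_mul_of_nonneg_left hunit.2 htpos⟩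

/-- **The assembled temperature axis of a cell** (two unit certificates at the ends of a `β̃`-interval ⇒
the physical energy window on the whole scale box). Along a common `Ls → ∞` let `ω̃₁`, `ω̃₂` be unit
thermal torus limits at the hot end `β̃₁ > 0` and the cold end `β̃₂` with certified `e_{Φ(1,s,u)}(ω̃₁) ≤ hi`
and `lo ≤ e_{Φ(1,s,u)}(ω̃₂)` (`0 ≤ n ≤ 2`). If `[βt₁, βt₂] ⊆ [β̃₁, β̃₂]` (`0 ≤ t₁`, `β ≥ 0`), then every
thermal torus limit (same `Ls`) of the physical model `H(t, ts, tu)` at `β`, for every `t ∈ [t₁, t₂]`,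
satisfies `t·lo ≤ e_{Φ(t,ts,tu)}(ω) ≤ t·hi` (monotonicity in `β̃`,
`meanEnergy_hubbardTTPrime_window_on_interval_of_sectorGibbs`, then §3). [cite: Ruelle1969, §2.5–2.6] -/
theorem meanEnergy_window_on_scaleBox_of_unit_endpoints
    (hn0 : 0 ≤ n) (hn2 : n ≤ 2) {β βu₁ βu₂ t₁ t₂ lo hi : ℝ} (hβu₁ : 0 < βu₁)
    (ht₁ : 0 ≤ t₁) (hβ : 0 ≤ β) (h₁ : βu₁ ≤ β * t₁) (h₂ : β * t₂ ≤ βu₂)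
    {ωu₁ ωu₂ : InfVolFermionState 2}
    (hu₁ : ωu₁.IsTorusLimitOfMixture (sectorGibbsCount n) (fun L => sectorGibbsWeightTT' βu₁ 1 s u n L)
      (fun L => sectorGibbsVectorTT' 1 s u n L) Ls)
    (hu₂ : ωu₂.IsTorusLimitOfMixture (sectorGibbsCount n) (fun L => sectorGibbsWeightTT' βu₂ 1 s u n L)
      (fun L => sectorGibbsVectorTT' 1 s u n L) Ls)
    (hLs : Tendsto Ls atTop atTop)
    (hlo : lo ≤ ωu₂.meanEnergy (hubbardTTPrimeFermionInteraction 1 s u) 1)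
    (hhi : ωu₁.meanEnergy (hubbardTTPrimeFermionInteraction 1 s u) 1 ≤ hi)
    {t : ℝ} (ht : t ∈ Set.Icc t₁ t₂) {ω : InfVolFermionState 2}
    (hω : ω.IsTorusLimitOfMixture (sectorGibbsCount n)
      (fun L => sectorGibbsWeightTT' β t (t * s) (t * u) n L)
      (fun L => sectorGibbsVectorTT' t (t * s) (t * u) n L) Ls) :
    t * lo ≤ ω.meanEnergy (hubbardTTPrimeFermionInteraction t (t * s) (t * u)) 1 ∧
      ω.meanEnergy (hubbardTTPrimeFermionInteraction t (t * s) (t * u)) 1 ≤ t * hi :=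
  meanEnergy_window_on_scaleBox_of_unit_Icc ht₁ hβ h₁ h₂
    (fun _ hβ' _ hω' => hu₁.meanEnergy_hubbardTTPrime_window_on_interval_of_sectorGibbs hn0 hn2 hβu₁
      hu₂ hLs hlo hhi hβ'.1 hβ'.2 hω') ht hω


end InfVolFermionState

end Literature.MathematicalPhysics.QuantumLattice

end
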